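import Mathlib.Data.Prod.Lex
import Mathlib.Data.Set.Finite.Lattice
import Mathlib.Data.Int.Interval
import Mathlib.RingTheory.PrincipalIdealDomain
import Literature.Algebra.EuclideanDomain.MotzkinConstruction
import HarnessLib

/-!
# `ℤ × ℤ` is Euclidean only for transfinite-valued algorithms (Samuel 1971, §3, Prop. 6 and Remark 2)

Topic `Literature/Algebra/EuclideanDomain`, namespace `Literature.Algebra.EuclideanDomain.IntProd` (continuing
`MotzkinConstruction.lean`: `motzkinSet k = P₀^{(k)}`, whose complements are the finite stages `A_k` of Samuel's
transfinite construction).  THEOREMS ONLY (no `def`, no instance, no named fact); everything PROVED.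

## Source (read at the page)

P. Samuel, *About Euclidean rings*, J. Algebra **19** (1971) 282–301 [Samuel1971] (materialised
`paper:doi-10-1016-0021-8693-71-90110-4`, pp. 282, 285–287), VERBATIM:
* Definition 1 (p. 282): an algorithm on `A` is a map `φ : A → W` into a well-ordered set with (E): «given
  `a, b ∈ A`, `b ≠ 0`, there exist `q` and `r` in `A` such that `a = bq + r` and `φ(r) < φ(b)`».
* Proposition 6 (p. 285): «A product of a finite number of Euclidean rings is euclidean.»  Proof (p. 286) for
  `A = A₁ × A₂`, `φᵢ : Aᵢ → Wᵢ`: «Let `W' = W₁ × W₂` lexicographically ordered … Call `W` the "ordinal sum" of two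
  copies of `W'` … with order-preserving injections `h', h'' : W' → W` such that `h'(λ) < h''(μ)` for all `λ, μ`.
  We define `φ : A₁ × A₂ → W` as follows: (i) If none or both of `x₁, x₂` are `0`, `φ(x₁, x₂) = h'((φ₁(x₁), φ₂(x₂)))`,
  (ii) If just one of `x₁, x₂` is `0`, `φ(x₁, x₂) = h''((φ₁(x₁), φ₂(x₂)))`», followed by the case analysis
  `b₁ ≠ 0 ≠ b₂` (remainders `(r₁, r₂)`, `(b₁, r₂)` with `q₁ − 1`, or `(r₁, b₂)` with `q₂ − 1`), `b₁ = 0 ≠ b₂`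
  (for `a₁ ≠ 0`: `a₂ = b₂q₂ + r₂` with `r₂ ≠ 0`, «possible if we exclude the trivial case in which `A₂` is the
  zero ring»; for `a₁ = 0`: the remainder `(0, r₂)`), and symmetrically.
* Remark 2 (pp. 286–287): «The use of transfinite valued algorithms, as in the proof of Prop. 6, is unavoidable
  in the case `A = ℤ × ℤ`.  In fact, we more generally notice: (F) If `A` is Euclidean for `φ`, if `A*` is finite
  and if `n` is an ordinary integer, then `A_n = φ⁻¹({n})` is finite. … suppose that `φ : ℤ × ℤ → ℕ` is an
  algorithm, and set `φ((1, 0)) = n`.  Then, as above in (F), `A'_n = A₀ ∪ … ∪ A_{n−1}` is finite and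
  `A'_n → (ℤ × ℤ)/((1, 0))` is surjective.  This is impossible since this last ring, isomorphic to `ℤ`, is
  infinite.»

## What is proved, and how

* `finite_compl_motzkinSet` — (F) for `ℤ × ℤ`, proved directly: every stage `A_k = (P₀^{(k)})ᶜ` of the
  transfinite construction of `ℤ × ℤ` is finite.  (Induction: `A_{k+1} = A_k ∪ {b : every class mod b meets A_k}`;
  if `A_k` lies in the box `max(|x|,|y|) ≤ M` then such a `b` has `0 < |b₁|, |b₂| ≤ 2M + 1`, since the class of
  `(M+1, M+1)` must meet `A_k`.)
* `one_zero_mem_motzkinSet` — `(1, 0) ∈ P₀^{(k)}` for every `k`: the classes of `(0, y)` modulo `(1, 0)` are the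
  lines `ℤ × {y}`, and a finite `A_k` misses some line.  Hence (`not_exists_euclideanFunction`,
  `not_exists_algorithm_nat`) **`ℤ × ℤ` admits no `ℕ`-valued algorithm**, in Motzkin's form (iii) and a
  fortiori in Samuel's Definition 1 with `W = ℕ`.
* `exists_transfinite_algorithm` — **Proposition 6 for `ℤ × ℤ`**: Samuel's map, with `W' = ℕ × ℕ`
  (lexicographic) and `W = W' ⊔ W'` realised as `ℕ ×ₗ (ℕ ×ₗ ℕ)` (first coordinate `0` for `h'`, `1` for `h''`):
  `φ(x, y) = (ε, (|x|, |y|))` with `ε = 0` if none or both of `x, y` vanish and `ε = 1` otherwise, IS an algorithm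
  (Definition 1) with values in a well-ordered set (`wellFoundedLT_lex`).
* `isPrincipalIdealRing` — `ℤ × ℤ` is a principal ideal ring (Remark 1, p. 286).
* `Prod.exists_transfinite_algorithm` (§4) — **Proposition 6 for two factors** `A₁ × A₂` each Euclidean for an
  `ℕ`-valued algorithm (Motzkin's criterion), with Samuel's map built from the smallest algorithms
  `θᵢ = motzkinRank` of the factors; `exists_transfinite_algorithm'` is the instance `ℤ × ℤ`.

## Mathlib / tree search

Mathlib: `Prod.Lex` (`ℕ ×ₗ ℕ`, `Prod.Lex.lt_iff`, `WellFoundedLT`), `isPrincipalIdealRing_prod_iff` /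
the instance for products, `Set.Finite` API (`Set.Finite.image`, `Set.finite_Icc`, `Set.infinite_univ`); nothing on Euclidean
algorithms for product rings.  Tree: `MotzkinConstruction.lean` (`exists_euclideanFunction_iff_forall_exists_not_mem_motzkinSet`,
valid for commutative rings with zero-divisors), `OfEuclideanFunction.lean` (`IsEuclideanFunction`).
-/

namespace Literature.Algebra.EuclideanDomain.IntProd

open Literature.Algebra.EuclideanDomain

/-! ## §1 The stages `A_k` of `ℤ × ℤ` are finite (Remark 2, (F)) -/

/-- The box argument: if `C ⊆ ℤ × ℤ` is finite, there is an `M` such that every `b` all of whose residue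
classes meet `C` satisfies `0 < |b₁| ≤ 2M + 1` and `0 < |b₂| ≤ 2M + 1` (test the class of `(M+1, M+1)`).
[cite: Samuel1971, §3 Remark 2 (pp. 286–287)] -/
theorem exists_bound_of_forall_exists_mem {C : Set (ℤ × ℤ)} (hC : C.Finite) :
    ∃ M : ℕ, ∀ b : ℤ × ℤ, (∀ a : ℤ × ℤ, ∃ q : ℤ × ℤ, a + b * q ∈ C) →
      b.1 ≠ 0 ∧ b.2 ≠ 0 ∧ b.1.natAbs ≤ 2 * M + 1 ∧ b.2.natAbs ≤ 2 * M + 1 := by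
  obtain ⟨M₁, hM₁⟩ := (hC.image fun c : ℤ × ℤ ↦ c.1.natAbs).bddAbove
  obtain ⟨M₂, hM₂⟩ := (hC.image fun c : ℤ × ℤ ↦ c.2.natAbs).bddAbove
  refine ⟨M₁ + M₂, fun b hb ↦ ?_⟩
  set M := M₁ + M₂ with hM
  obtain ⟨q, hq⟩ := hb ((M : ℤ) + 1, (M : ℤ) + 1)
  have h1 : ((M : ℤ) + 1 + b.1 * q.1).natAbs ≤ M₁ :=
    hM₁ (Set.mem_image_of_mem (fun c : ℤ × ℤ ↦ c.1.natAbs) hq)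
  have h2 : ((M : ℤ) + 1 + b.2 * q.2).natAbs ≤ M₂ :=
    hM₂ (Set.mem_image_of_mem (fun c : ℤ × ℤ ↦ c.2.natAbs) hq)
  -- first coordinate
  have hb1 : b.1 ≠ 0 ∧ b.1.natAbs ≤ 2 * M + 1 := by
    rcases eq_or_ne b.1 0 with hb0 | hb0
    · rw [hb0, zero_mul, add_zero] at h1; omega
    refine ⟨hb0, ?_⟩
    rcases eq_or_ne q.1 0 with hq0 | hq0
    · rw [hq0, mul_zero, add_zero] at h1; omega
    · have hle : b.1.natAbs ≤ (b.1 * q.1).natAbs := by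
        rw [Int.natAbs_mul]; exact Nat.le_mul_of_pos_right _ (Int.natAbs_pos.mpr hq0)
      generalize b.1 * q.1 = m at h1 hle
      omega
  -- second coordinate
  have hb2 : b.2 ≠ 0 ∧ b.2.natAbs ≤ 2 * M + 1 := by
    rcases eq_or_ne b.2 0 with hb0 | hb0
    · rw [hb0, zero_mul, add_zero] at h2; omega
    refine ⟨hb0, ?_⟩
    rcases eq_or_ne q.2 0 with hq0 | hq0
    · rw [hq0, mul_zero, add_zero] at h2; omega
    · have hle : b.2.natAbs ≤ (b.2 * q.2).natAbs := by
        rw [Int.natAbs_mul]; exact Nat.le_mul_of_pos_right _ (Int.natAbs_pos.mpr hq0)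
      generalize b.2 * q.2 = m at h2 hle
      omega
  exact ⟨hb1.1, hb2.1, hb1.2, hb2.2⟩

/-- The recursion of the transfinite construction: `A_{k+1} = A_k ∪ {b : A_k ↠ (ℤ×ℤ)/(b)}`, i.e.
`b ∉ P₀^{(k+1)} ↔ b ∉ P₀^{(k)} ∨ ∀ a, ∃ q, a + bq ∉ P₀^{(k)}`. [cite: Samuel1971, §4 (p. 289)] -/
theorem not_mem_motzkinSet_succ_iff {R : Type*} [CommRing R] (k : ℕ) (b : R) :
    b ∉ (motzkinSet (k + 1) : Set R) ↔ b ∉ (motzkinSet k : Set R) ∨ ∀ a : R, ∃ q : R, a + b * q ∉ (motzkinSet k : Set R) := by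
  rw [motzkinSet_succ, mem_motzkinDerived, not_and, imp_iff_not_or]
  push Not
  rfl

/-- **(F) for `ℤ × ℤ`**: every stage `A_k = (P₀^{(k)})ᶜ` of the transfinite construction of `ℤ × ℤ` is finite.
[cite: Samuel1971, §3 Remark 2 (pp. 286–287)] -/
theorem finite_compl_motzkinSet (k : ℕ) : ((motzkinSet k : Set (ℤ × ℤ))ᶜ).Finite := by
  induction k with
  | zero =>
    refine (Set.finite_singleton (0 : ℤ × ℤ)).subset fun b hb ↦ ?_
    simpa [motzkinSet_zero] using hb
  | succ k ih =>
    obtain ⟨M, hM⟩ := exists_bound_of_forall_exists_mem ih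
    set N : ℤ := 2 * M + 1 with hN
    have hbox : (Set.Icc (-N) N ×ˢ Set.Icc (-N) N : Set (ℤ × ℤ)).Finite :=
      (Set.finite_Icc _ _).prod (Set.finite_Icc _ _)
    refine (ih.union hbox).subset fun b hb ↦ ?_
    rw [Set.mem_compl_iff, not_mem_motzkinSet_succ_iff] at hb
    rcases hb with hb | hb
    · exact Or.inl hb
    · right
      obtain ⟨-, -, h1, h2⟩ := hM b (fun a ↦ by
        obtain ⟨q, hq⟩ := hb a
        exact ⟨q, hq⟩)
      simp only [Set.mem_prod, Set.mem_Icc]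
      omega

/-! ## §2 `(1, 0)` never leaves the sequence `P₀ ⊇ P₀′ ⊇ ⋯`: no `ℕ`-valued algorithm -/

/-- `(1, 0) ∈ P₀^{(k)}` for every `k`: the residue classes modulo `(1,0)` are the lines `ℤ × {y}`, and the finite
stage `A_k` misses one of them («`A'_n → (ℤ × ℤ)/((1,0))` is surjective.  This is impossible since this last
ring, isomorphic to `ℤ`, is infinite»). [cite: Samuel1971, §3 Remark 2 (p. 287)] -/
theorem one_zero_mem_motzkinSet (k : ℕ) : ((1, 0) : ℤ × ℤ) ∈ (motzkinSet k : Set (ℤ × ℤ)) := by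
  induction k with
  | zero => simp [motzkinSet_zero]
  | succ k ih =>
    rw [motzkinSet_succ, mem_motzkinDerived]
    refine ⟨ih, ?_⟩
    -- a second coordinate `y₀` not occurring in the finite set `A_k`
    have hfin := (finite_compl_motzkinSet k).image Prod.snd
    obtain ⟨y₀, hy₀⟩ : ∃ y₀ : ℤ, y₀ ∉ Prod.snd '' (motzkinSet k : Set (ℤ × ℤ))ᶜ := by
      by_contra h
      push Not at h
      exact Set.infinite_univ (hfin.subset fun y _ ↦ h y)
    refine ⟨(0, y₀), fun q ↦ ?_⟩
    by_contra h
    refine hy₀ ⟨(0, y₀) + (1, 0) * q, h, ?_⟩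
    simp

/-- **«The use of transfinite valued algorithms is unavoidable in the case `A = ℤ × ℤ`»**: `ℤ × ℤ` carries no
`ℕ`-valued Euclidean function (Motzkin's form (iii): `a = bq + s`, `s = 0 ∨ φ s < φ b`), by Motzkin's criterion
at `b = (1, 0)`. [cite: Samuel1971, §3 Remark 2 (pp. 286–287)] -/
theorem not_exists_euclideanFunction :
    ¬ ∃ φ : ℤ × ℤ → ℕ, ∀ a b : ℤ × ℤ, b ≠ 0 → ∃ q s : ℤ × ℤ, a = b * q + s ∧ (s = 0 ∨ φ s < φ b) := by
  rw [exists_euclideanFunction_iff_forall_exists_not_mem_motzkinSet]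
  intro h
  obtain ⟨k, hk⟩ := h (1, 0)
  exact hk (one_zero_mem_motzkinSet k)

/-- The same for Samuel's Definition 1 with `W = ℕ` («suppose that `φ : ℤ × ℤ → ℕ` is an algorithm … This is
impossible»). [cite: Samuel1971, §3 Remark 2 (p. 287)] -/
theorem not_exists_algorithm_nat :
    ¬ ∃ φ : ℤ × ℤ → ℕ, ∀ a b : ℤ × ℤ, b ≠ 0 → ∃ q r : ℤ × ℤ, a = b * q + r ∧ φ r < φ b := by
  rintro ⟨φ, hφ⟩
  exact not_exists_euclideanFunction ⟨φ, fun a b hb ↦ by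
    obtain ⟨q, r, h1, h2⟩ := hφ a b hb
    exact ⟨q, r, h1, Or.inr h2⟩⟩

/-- Nor is there a Euclidean function in Alaca–Williams' sense (`IsEuclideanFunction`).
[cite: Samuel1971, §3 Remark 2 (p. 287)] -/
theorem not_exists_isEuclideanFunction : ¬ ∃ φ : ℤ × ℤ → ℕ, IsEuclideanFunction φ := by
  rintro ⟨φ, hφ⟩
  exact not_exists_algorithm_nat ⟨φ, hφ.exists_remainder⟩

/-! ## §3 Proposition 6 for `ℤ × ℤ`: a transfinite-valued algorithm -/

/-- The value set `W = W' ⊔ W'`, `W' = ℕ × ℕ` lexicographic, realised as `ℕ ×ₗ (ℕ ×ₗ ℕ)`, is well ordered.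
[cite: Samuel1971, Prop. 6 (p. 286)] -/
theorem wellFoundedLT_lex : WellFoundedLT (ℕ ×ₗ (ℕ ×ₗ ℕ)) := inferInstance

/-- Comparison in `ℕ ×ₗ (ℕ ×ₗ ℕ)`. [cite: Samuel1971, Prop. 6 (p. 286)] -/
theorem toLex_lt_toLex_iff (i x y i' x' y' : ℕ) :
    (toLex (i, toLex (x, y)) : ℕ ×ₗ (ℕ ×ₗ ℕ)) < toLex (i', toLex (x', y')) ↔
      i < i' ∨ i = i' ∧ (x < x' ∨ x = x' ∧ y < y') := by
  simp only [Prod.Lex.lt_iff, ofLex_toLex]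

/-- Division in `ℤ` with a NON-ZERO remainder of absolute value `≤ |b|` (Samuel: «write `a₂ = b₂q₂ + r₂` with
`r₂ ≠ 0` (this is possible if we exclude the trivial case in which `A₂` is the zero ring)»): either the usual
remainder, or `b` itself. [cite: Samuel1971, Prop. 6 (p. 286)] -/
theorem Int.exists_eq_mul_add_ne_zero (a b : ℤ) (hb : b ≠ 0) :
    ∃ q r : ℤ, a = b * q + r ∧ r ≠ 0 ∧ r.natAbs ≤ b.natAbs := by
  have hdm := Int.emod_def a b
  by_cases h : a % b = 0
  · refine ⟨a / b - 1, b, ?_, hb, le_rfl⟩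
    rw [h] at hdm
    linear_combination -hdm
  · refine ⟨a / b, a % b, by linear_combination -hdm, h, ?_⟩
    have h1 := Int.emod_nonneg a hb
    have h2 := Int.emod_lt_abs a hb
    rw [← Int.natCast_natAbs] at h2
    omega

/-- Division in `ℤ` with remainder of absolute value `< |b|`. [cite: Samuel1971, §3 (p. 285)] -/
theorem Int.exists_eq_mul_add_natAbs_lt (a b : ℤ) (hb : b ≠ 0) :
    ∃ q r : ℤ, a = b * q + r ∧ r.natAbs < b.natAbs := by
  have hdm := Int.emod_def a b
  refine ⟨a / b, a % b, by linear_combination -hdm, ?_⟩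
  have h1 := Int.emod_nonneg a hb
  have h2 := Int.emod_lt_abs a hb
  rw [← Int.natCast_natAbs] at h2
  omega

/-- **Proposition 6 for `ℤ × ℤ`** (Samuel's construction with `φ₁ = φ₂ = |·|`): the map
`φ(x, y) = (ε(x,y), (|x|, |y|)) ∈ ℕ ×ₗ (ℕ ×ₗ ℕ)`, `ε = 0` if none or both of `x, y` are `0` and `ε = 1` if
exactly one of them is, is an algorithm in the sense of Definition 1: for `b ≠ 0` every `a` is `bq + r` with
`φ(r) < φ(b)`. [cite: Samuel1971, Prop. 6 (pp. 285–286)] -/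
theorem exists_transfinite_algorithm :
    ∃ φ : ℤ × ℤ → ℕ ×ₗ (ℕ ×ₗ ℕ),
      (∀ x : ℤ × ℤ, φ x = toLex (if (x.1 = 0 ↔ x.2 = 0) then 0 else 1, toLex (x.1.natAbs, x.2.natAbs))) ∧
      ∀ a b : ℤ × ℤ, b ≠ 0 → ∃ q r : ℤ × ℤ, a = b * q + r ∧ φ r < φ b := by
  refine ⟨fun x ↦ toLex (if (x.1 = 0 ↔ x.2 = 0) then 0 else 1, toLex (x.1.natAbs, x.2.natAbs)),
    fun x ↦ rfl, ?_⟩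
  rintro ⟨a₁, a₂⟩ ⟨b₁, b₂⟩ hb
  simp only [ne_eq, Prod.mk_eq_zero, not_and_or] at hb
  by_cases hb1 : b₁ = 0
  · -- `b = (0, b₂)`, `b₂ ≠ 0`, `φ(b) = (1, (0, |b₂|))`
    have hb2 : b₂ ≠ 0 := by tauto
    subst hb1
    by_cases ha1 : a₁ = 0
    · subst ha1
      obtain ⟨q₂, r₂, h, hr⟩ := Int.exists_eq_mul_add_natAbs_lt a₂ b₂ hb2
      refine ⟨(0, q₂), (0, r₂), by simp only [Prod.mk_mul_mk, Prod.mk_add_mk, Prod.mk.injEq]; exact ⟨by ring, by linear_combination h⟩, ?_⟩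
      simp only [toLex_lt_toLex_iff, Int.natAbs_zero]
      by_cases hr0 : r₂ = 0
      · subst hr0; left; simp [hb2]
      · right; simp [hr0, hb2, hr]
    · obtain ⟨q₂, r₂, h, hr, -⟩ := Int.exists_eq_mul_add_ne_zero a₂ b₂ hb2
      refine ⟨(0, q₂), (a₁, r₂), by simp only [Prod.mk_mul_mk, Prod.mk_add_mk, Prod.mk.injEq]; exact ⟨by ring, by linear_combination h⟩, ?_⟩
      simp only [toLex_lt_toLex_iff]
      left; simp [ha1, hr, hb2]
  by_cases hb2 : b₂ = 0
  · -- `b = (b₁, 0)`, `b₁ ≠ 0`, `φ(b) = (1, (|b₁|, 0))`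
    subst hb2
    by_cases ha2 : a₂ = 0
    · subst ha2
      obtain ⟨q₁, r₁, h, hr⟩ := Int.exists_eq_mul_add_natAbs_lt a₁ b₁ hb1
      refine ⟨(q₁, 0), (r₁, 0), by simp only [Prod.mk_mul_mk, Prod.mk_add_mk, Prod.mk.injEq]; exact ⟨by linear_combination h, by ring⟩, ?_⟩
      simp only [toLex_lt_toLex_iff, Int.natAbs_zero]
      by_cases hr0 : r₁ = 0
      · subst hr0; left; simp [hb1]
      · right; simp [hr0, hb1, hr]
    · obtain ⟨q₁, r₁, h, hr, -⟩ := Int.exists_eq_mul_add_ne_zero a₁ b₁ hb1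
      refine ⟨(q₁, 0), (r₁, a₂), by simp only [Prod.mk_mul_mk, Prod.mk_add_mk, Prod.mk.injEq]; exact ⟨by linear_combination h, by ring⟩, ?_⟩
      simp only [toLex_lt_toLex_iff]
      left; simp [ha2, hr, hb1]
  · -- `b₁ ≠ 0 ≠ b₂`, `φ(b) = (0, (|b₁|, |b₂|))`
    obtain ⟨q₁, r₁, h1, hr1⟩ := Int.exists_eq_mul_add_natAbs_lt a₁ b₁ hb1
    obtain ⟨q₂, r₂, h2, hr2⟩ := Int.exists_eq_mul_add_natAbs_lt a₂ b₂ hb2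
    by_cases hr10 : r₁ = 0
    · by_cases hr20 : r₂ = 0
      · -- both remainders vanish: `r = 0`
        refine ⟨(q₁, q₂), (0, 0), by simp only [Prod.mk_mul_mk, Prod.mk_add_mk, Prod.mk.injEq]; exact ⟨by linear_combination h1 + hr10, by linear_combination h2 + hr20⟩, ?_⟩
        simp only [toLex_lt_toLex_iff, Int.natAbs_zero]
        right; simp [hb1, hb2, Int.natAbs_pos.mpr hb1]
      · -- `r₁ = 0 ≠ r₂`: use `(b₁, r₂)` and `q₁ − 1`
        refine ⟨(q₁ - 1, q₂), (b₁, r₂), by simp only [Prod.mk_mul_mk, Prod.mk_add_mk, Prod.mk.injEq]; exact ⟨by linear_combination h1 + hr10, by linear_combination h2⟩, ?_⟩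
        simp only [toLex_lt_toLex_iff]
        right; simp [hb1, hb2, hr20, hr2]
    · by_cases hr20 : r₂ = 0
      · -- `r₁ ≠ 0 = r₂`: use `(r₁, b₂)` and `q₂ − 1`
        refine ⟨(q₁, q₂ - 1), (r₁, b₂), by simp only [Prod.mk_mul_mk, Prod.mk_add_mk, Prod.mk.injEq]; exact ⟨by linear_combination h1, by linear_combination h2 + hr20⟩, ?_⟩
        simp only [toLex_lt_toLex_iff]
        right; simp [hb1, hb2, hr10, hr1]
      · refine ⟨(q₁, q₂), (r₁, r₂), by simp only [Prod.mk_mul_mk, Prod.mk_add_mk, Prod.mk.injEq]; exact ⟨by linear_combination h1, by linear_combination h2⟩, ?_⟩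
        simp only [toLex_lt_toLex_iff]
        right; simp [hb1, hb2, hr10, hr20, hr1]

/-- `ℤ × ℤ` is nevertheless a principal ideal ring (Remark 1: principal ideal rings are finite products of
principal ideal domains and special principal ideal rings). [cite: Samuel1971, §3 Remark 1 (p. 286)] -/
theorem isPrincipalIdealRing : IsPrincipalIdealRing (ℤ × ℤ) := inferInstance

/-! ## §4 Proposition 6 for two factors that are Euclidean for `ℕ`-valued algorithms

Samuel's construction verbatim, with `φᵢ` the smallest algorithms `θᵢ = motzkinRank hᵢ` of the factors (so that
`φᵢ(0) = 0 < φᵢ(x)` for `x ≠ 0`, as for Samuel's normalised algorithms, Prop. 1): the product `A₁ × A₂` of two rings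
satisfying Motzkin's criterion is Euclidean for an algorithm with values in `W' ⊔ W'`, `W' = ℕ × ℕ` lexicographic —
although, by §2, in general for no `ℕ`-valued one. -/

/-- Division with a NON-ZERO remainder by the smallest algorithm (Samuel: «write `a₂ = b₂q₂ + r₂` with `r₂ ≠ 0`
(this is possible if we exclude the trivial case in which `A₂` is the zero ring)»: if the remainder vanishes, use
`b` itself and `q − 1`). [cite: Samuel1971, Prop. 6 (p. 286)] -/
theorem exists_eq_mul_add_ne_zero {R : Type*} [CommRing R] (h : ∀ b : R, ∃ k : ℕ, b ∉ motzkinSet k)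
    (a b : R) (hb : b ≠ 0) : ∃ q r : R, a = b * q + r ∧ r ≠ 0 ∧ motzkinRank h r ≤ motzkinRank h b := by
  obtain ⟨q, r, hqr, hlt⟩ := exists_remainder_motzkinRank h a b hb
  by_cases hr : r = 0
  · exact ⟨q - 1, b, by rw [hqr, hr]; ring, hb, le_rfl⟩
  · exact ⟨q, r, hqr, hr, hlt.le⟩

/-- **Proposition 6** (two factors, `ℕ`-Euclidean in Motzkin's sense): if `A₁` and `A₂` satisfy Motzkin's criterion,
then `φ(x₁, x₂) = (ε, (θ₁ x₁, θ₂ x₂)) ∈ ℕ ×ₗ (ℕ ×ₗ ℕ)` — `θᵢ` the smallest algorithms, `ε = 0` if none or both of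
`x₁, x₂` are `0` and `ε = 1` if just one of them is — is an algorithm on `A₁ × A₂` in the sense of Definition 1
(values in a well-ordered set). [cite: Samuel1971, Prop. 6 (pp. 285–286)] -/
theorem Prod.exists_transfinite_algorithm {A₁ A₂ : Type*} [CommRing A₁] [CommRing A₂]
    (h₁ : ∀ b : A₁, ∃ k : ℕ, b ∉ motzkinSet k) (h₂ : ∀ b : A₂, ∃ k : ℕ, b ∉ motzkinSet k) :
    ∃ φ : A₁ × A₂ → ℕ ×ₗ (ℕ ×ₗ ℕ), ∀ a b : A₁ × A₂, b ≠ 0 → ∃ q r : A₁ × A₂, a = b * q + r ∧ φ r < φ b := by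
  classical
  refine ⟨fun x ↦ toLex (if (x.1 = 0 ↔ x.2 = 0) then 0 else 1, toLex (motzkinRank h₁ x.1, motzkinRank h₂ x.2)), ?_⟩
  have hr1 : ∀ x : A₁, motzkinRank h₁ x = 0 ↔ x = 0 := fun x ↦ motzkinRank_eq_zero_iff h₁
  have hr2 : ∀ x : A₂, motzkinRank h₂ x = 0 ↔ x = 0 := fun x ↦ motzkinRank_eq_zero_iff h₂
  rintro ⟨a₁, a₂⟩ ⟨b₁, b₂⟩ hb
  simp only [ne_eq, Prod.mk_eq_zero, not_and_or] at hb
  by_cases hb1 : b₁ = 0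
  · -- `b = (0, b₂)`, `b₂ ≠ 0`, `φ(b) = (1, (0, θ₂ b₂))`
    have hb2 : b₂ ≠ 0 := by tauto
    subst hb1
    by_cases ha1 : a₁ = 0
    · subst ha1
      obtain ⟨q₂, r₂, h, hr⟩ := exists_remainder_motzkinRank h₂ a₂ b₂ hb2
      refine ⟨(0, q₂), (0, r₂),
        by simp only [Prod.mk_mul_mk, Prod.mk_add_mk, Prod.mk.injEq]; exact ⟨by ring, by linear_combination h⟩, ?_⟩
      simp only [toLex_lt_toLex_iff, (hr1 0).mpr rfl]
      by_cases hr0 : r₂ = 0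
      · subst hr0; left; simp [hb2]
      · right; simp [hr0, hb2, hr]
    · obtain ⟨q₂, r₂, h, hr, -⟩ := exists_eq_mul_add_ne_zero h₂ a₂ b₂ hb2
      refine ⟨(0, q₂), (a₁, r₂),
        by simp only [Prod.mk_mul_mk, Prod.mk_add_mk, Prod.mk.injEq]; exact ⟨by ring, by linear_combination h⟩, ?_⟩
      simp only [toLex_lt_toLex_iff]
      left; simp [ha1, hr, hb2]
  by_cases hb2 : b₂ = 0
  · -- `b = (b₁, 0)`, `b₁ ≠ 0`, `φ(b) = (1, (θ₁ b₁, 0))`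
    subst hb2
    by_cases ha2 : a₂ = 0
    · subst ha2
      obtain ⟨q₁, r₁, h, hr⟩ := exists_remainder_motzkinRank h₁ a₁ b₁ hb1
      refine ⟨(q₁, 0), (r₁, 0),
        by simp only [Prod.mk_mul_mk, Prod.mk_add_mk, Prod.mk.injEq]; exact ⟨by linear_combination h, by ring⟩, ?_⟩
      simp only [toLex_lt_toLex_iff, (hr2 0).mpr rfl]
      by_cases hr0 : r₁ = 0
      · subst hr0; left; simp [hb1]
      · right
        refine ⟨by simp [hr0, hb1], Or.inl hr⟩
    · obtain ⟨q₁, r₁, h, hr, -⟩ := exists_eq_mul_add_ne_zero h₁ a₁ b₁ hb1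
      refine ⟨(q₁, 0), (r₁, a₂),
        by simp only [Prod.mk_mul_mk, Prod.mk_add_mk, Prod.mk.injEq]; exact ⟨by linear_combination h, by ring⟩, ?_⟩
      simp only [toLex_lt_toLex_iff]
      left; simp [ha2, hr, hb1]
  · -- `b₁ ≠ 0 ≠ b₂`, `φ(b) = (0, (θ₁ b₁, θ₂ b₂))`
    obtain ⟨q₁, r₁, e1, hlt1⟩ := exists_remainder_motzkinRank h₁ a₁ b₁ hb1
    obtain ⟨q₂, r₂, e2, hlt2⟩ := exists_remainder_motzkinRank h₂ a₂ b₂ hb2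
    have hpos : 0 < motzkinRank h₁ b₁ := Nat.pos_of_ne_zero fun h0 ↦ hb1 ((hr1 b₁).mp h0)
    by_cases hr10 : r₁ = 0
    · by_cases hr20 : r₂ = 0
      · refine ⟨(q₁, q₂), (0, 0), by
          simp only [Prod.mk_mul_mk, Prod.mk_add_mk, Prod.mk.injEq]
          exact ⟨by linear_combination e1 + hr10, by linear_combination e2 + hr20⟩, ?_⟩
        simp only [toLex_lt_toLex_iff, (hr1 0).mpr rfl, (hr2 0).mpr rfl]
        right; simp [hb1, hb2, hpos]
      · refine ⟨(q₁ - 1, q₂), (b₁, r₂), by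
          simp only [Prod.mk_mul_mk, Prod.mk_add_mk, Prod.mk.injEq]
          exact ⟨by linear_combination e1 + hr10, by linear_combination e2⟩, ?_⟩
        simp only [toLex_lt_toLex_iff]
        right; simp [hb1, hb2, hr20, hlt2]
    · by_cases hr20 : r₂ = 0
      · refine ⟨(q₁, q₂ - 1), (r₁, b₂), by
          simp only [Prod.mk_mul_mk, Prod.mk_add_mk, Prod.mk.injEq]
          exact ⟨by linear_combination e1, by linear_combination e2 + hr20⟩, ?_⟩
        simp only [toLex_lt_toLex_iff]
        right; simp [hb1, hb2, hr10, hlt1]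
      · refine ⟨(q₁, q₂), (r₁, r₂), by
          simp only [Prod.mk_mul_mk, Prod.mk_add_mk, Prod.mk.injEq]
          exact ⟨by linear_combination e1, by linear_combination e2⟩, ?_⟩
        simp only [toLex_lt_toLex_iff]
        right; simp [hb1, hb2, hr10, hr20, hlt1]

/-- In particular `ℤ × ℤ` (each factor satisfying Motzkin's criterion, `Int.forall_exists_not_mem_motzkinSet`) is
Euclidean for the algorithm `(ε, (θ(x), θ(y)))`, `θ` = number of binary digits — Proposition 6 with the smallest
algorithms of the factors instead of `|·|`. [cite: Samuel1971, Prop. 6 (pp. 285–286)] -/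
theorem exists_transfinite_algorithm' :
    ∃ φ : ℤ × ℤ → ℕ ×ₗ (ℕ ×ₗ ℕ), ∀ a b : ℤ × ℤ, b ≠ 0 → ∃ q r : ℤ × ℤ, a = b * q + r ∧ φ r < φ b :=
  Prod.exists_transfinite_algorithm Int.forall_exists_not_mem_motzkinSet Int.forall_exists_not_mem_motzkinSet

end Literature.Algebra.EuclideanDomain.IntProd
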